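import Summits.AtomisticToContinuum.Crystallization.Theorems.ExcessDecayLiouvilleHcpLiouvilleBlowdownGreenCrossA
import Summits.AtomisticToContinuum.Crystallization.Theorems.ExcessDecayLiouvilleHcpLiouvilleBlowdownGreenShift
import Summits.AtomisticToContinuum.Crystallization.Theorems.ExcessDecayLiouvilleLatticeParam

/-!
# `ExcessDecayLiouville.HcpLiouville` (stmt-AtomisticToContinuum-9332), line `Sketch` v4: the cross-sublattice identity

Part H3d-II of stub `stub_green`, lead file.  For a solution operator `𝒢` with the clauses of the registered sub-goal
`blowdown_greenSolve` (taken literally as hypotheses: homogeneity (v), additivity (vii), countable additivity (viii),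
self-reproduction (ix), lattice covariance (vi)), write `G_c η := 𝒢 (δ_c η)`, `a = t 0`, `b = t 1`,
`η_q = K(a − q) ξ` and `K_c ξ = Σ_{q ∈ S₁} η_q` (the optical force-constant matrix applied to `ξ`).  Applying `𝒢` to the
dipole decomposition `L(δ_a ξ) = Σ_q (δ_a − δ_q) η_q` (part H3d-I) and moving every `G_q` to `G_a` or `G_b` by a lattice
translation gives, at every site `p`,

`(G_a − G_b)(K_c ξ)(p) = δ_a ξ (p) − Σ_q T_q(p)`,  `T_q(p) = [q∈S₁] (G_b η_q (p) − G_b η_q (p − q + b)) + [q∈S₀] (G_a η_q (p) − G_a η_q (p − q + a))`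

(`Blowdown.cross_identity`, as a `HasSum` over `q ∈ S`).  Part III bounds the right-hand side in `ℓ²` and inverts `K_c`.
All `[folklore]`; a `--supports` helper for item stmt-AtomisticToContinuum-9332, nothing here closes an item.
-/

noncomputable section

namespace Summit.AtomisticToContinuum.Crystallization.Theorems.ExcessDecayLiouville

open scoped BigOperators Topology Classical InnerProductSpace RealInnerProductSpace
open Literature.MathematicalPhysics.StatisticalMechanics
open Summit.AtomisticToContinuum.Crystallization.Theses.ExcessDecayLiouville
open Summit.AtomisticToContinuum.Crystallization.Theorems.PhononStabilityNegative

namespace Blowdown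

section

variable {t : Fin 2 → EuclideanSpace ℝ (Fin 3)} {A : EuclideanSpace ℝ (Fin 3) →L[ℝ] EuclideanSpace ℝ (Fin 3)}
  {𝒢 : (EuclideanSpace ℝ (Fin 3) → EuclideanSpace ℝ (Fin 3)) → EuclideanSpace ℝ (Fin 3) → EuclideanSpace ℝ (Fin 3)}

/-! ## Elementary consequences of the clauses -/

/-- The zero field is admissible with constant `0`. [folklore] -/
theorem adm_zero :
    ∀ w : EuclideanSpace ℝ (Fin 3) → EuclideanSpace ℝ (Fin 3), (Function.support w).Finite →
      Function.support w ⊆ Sites₀ t A →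
        |∑' p : Sites₀ t A, ⟪(0 : EuclideanSpace ℝ (Fin 3) → EuclideanSpace ℝ (Fin 3)) p, w p⟫| ≤
          0 * Real.sqrt (nnForm t A w) := by
  intro w _ _
  simp

/-- `𝒢 0 = 0` on the sites, from homogeneity (v). [folklore] -/
theorem green_zero
    (hv : ∀ (f : EuclideanSpace ℝ (Fin 3) → EuclideanSpace ℝ (Fin 3)) (N : ℝ), 0 ≤ N →
      (∀ w : EuclideanSpace ℝ (Fin 3) → EuclideanSpace ℝ (Fin 3), (Function.support w).Finite →
        Function.support w ⊆ Sites₀ t A → |∑' p : Sites₀ t A, ⟪f p, w p⟫| ≤ N * Real.sqrt (nnForm t A w)) →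
      ∀ c : ℝ, ∀ p ∈ Sites₀ t A, 𝒢 (c • f) p = c • 𝒢 f p)
    {p : EuclideanSpace ℝ (Fin 3)} (hp : p ∈ Sites₀ t A) :
    𝒢 (0 : EuclideanSpace ℝ (Fin 3) → EuclideanSpace ℝ (Fin 3)) p = 0 := by
  have h := hv 0 0 le_rfl adm_zero 0 p hp
  rwa [zero_smul, zero_smul] at h

/-- **Response to a dipole**: `𝒢 ((δ_c − δ_q) η) = G_c η − G_q η` on the sites, from additivity (vii), homogeneity (v)
and the admissibility of point forces (capacity `C₁`). [folklore] -/
theorem green_dipole_eq {C₁ : ℝ}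
    (hcap : ∀ w : EuclideanSpace ℝ (Fin 3) → EuclideanSpace ℝ (Fin 3), (Function.support w).Finite →
      Function.support w ⊆ Sites₀ t A → ∀ p ∈ Sites₀ t A, ‖w p‖ ^ 2 ≤ C₁ * nnForm t A w)
    (hv : ∀ (f : EuclideanSpace ℝ (Fin 3) → EuclideanSpace ℝ (Fin 3)) (N : ℝ), 0 ≤ N →
      (∀ w : EuclideanSpace ℝ (Fin 3) → EuclideanSpace ℝ (Fin 3), (Function.support w).Finite →
        Function.support w ⊆ Sites₀ t A → |∑' p : Sites₀ t A, ⟪f p, w p⟫| ≤ N * Real.sqrt (nnForm t A w)) →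
      ∀ c : ℝ, ∀ p ∈ Sites₀ t A, 𝒢 (c • f) p = c • 𝒢 f p)
    (hvii : ∀ (f g : EuclideanSpace ℝ (Fin 3) → EuclideanSpace ℝ (Fin 3)) (Nf Ng : ℝ), 0 ≤ Nf → 0 ≤ Ng →
      (∀ w : EuclideanSpace ℝ (Fin 3) → EuclideanSpace ℝ (Fin 3), (Function.support w).Finite →
        Function.support w ⊆ Sites₀ t A → |∑' p : Sites₀ t A, ⟪f p, w p⟫| ≤ Nf * Real.sqrt (nnForm t A w)) →
      (∀ w : EuclideanSpace ℝ (Fin 3) → EuclideanSpace ℝ (Fin 3), (Function.support w).Finite →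
        Function.support w ⊆ Sites₀ t A → |∑' p : Sites₀ t A, ⟪g p, w p⟫| ≤ Ng * Real.sqrt (nnForm t A w)) →
      ∀ p ∈ Sites₀ t A, 𝒢 (f + g) p = 𝒢 f p + 𝒢 g p)
    {c q : EuclideanSpace ℝ (Fin 3)} (hc : c ∈ Sites₀ t A) (hq : q ∈ Sites₀ t A) (η : EuclideanSpace ℝ (Fin 3))
    {p : EuclideanSpace ℝ (Fin 3)} (hp : p ∈ Sites₀ t A) :
    𝒢 (fun y : EuclideanSpace ℝ (Fin 3) => (if y = c then η else 0) - (if y = q then η else 0)) p =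
      𝒢 (fun y => if y = c then η else 0) p - 𝒢 (fun y => if y = q then η else 0) p := by
  have hN : 0 ≤ Real.sqrt C₁ * ‖η‖ := by positivity
  have hc' := adm_single (t := t) (A := A) hcap hc η
  have hq' := adm_single (t := t) (A := A) hcap hq η
  have hq'' := adm_smul (t := t) (A := A) (f := fun y : EuclideanSpace ℝ (Fin 3) => if y = q then η else 0) (-1 : ℝ) hq'
  have hsplit : (fun y : EuclideanSpace ℝ (Fin 3) => (if y = c then η else 0) - (if y = q then η else 0)) =
      (fun y : EuclideanSpace ℝ (Fin 3) => if y = c then η else 0) + (-1 : ℝ) • (fun y : EuclideanSpace ℝ (Fin 3) => if y = q then η else 0) := by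
    funext y
    simp only [Pi.add_apply, Pi.neg_apply, neg_one_smul, sub_eq_add_neg]
  rw [hsplit, hvii (fun y : EuclideanSpace ℝ (Fin 3) => if y = c then η else 0)
      ((-1 : ℝ) • fun y : EuclideanSpace ℝ (Fin 3) => if y = q then η else 0) (Real.sqrt C₁ * ‖η‖)
      (|(-1 : ℝ)| * (Real.sqrt C₁ * ‖η‖)) hN (by positivity) hc' hq'' p hp,
    hv (fun y : EuclideanSpace ℝ (Fin 3) => if y = q then η else 0) (Real.sqrt C₁ * ‖η‖) hN hq' (-1) p hp]
  rw [neg_one_smul, sub_eq_add_neg]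

/-! ## The optical vector `K_c ξ` and the dipole family across the sublattices -/

/-- The cross family `q ↦ [q ∈ S₁] K(a−q) ξ` is summable (`a = t 0`). [folklore] -/
theorem summable_crossVec (hA : Adm₀ A) (hI : Inner₀ t A) (ξ : EuclideanSpace ℝ (Fin 3)) :
    Summable (fun q : Sites₀ t A => (if ∃ z ∈ Λ₀, (q : EuclideanSpace ℝ (Fin 3)) = t 1 + A z then
      forceConst (t 0 - q) ξ else 0)) := by
  have h0 : t 0 ∈ Sites₀ t A := ⟨0, 0, zero_mem_Λ₀, by simp⟩
  refine Summable.of_norm_bounded (summable_offdiag hA hI h0 ξ).norm fun q => ?_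
  by_cases h1 : ∃ z ∈ Λ₀, (q : EuclideanSpace ℝ (Fin 3)) = t 1 + A z
  · have hne : (q : EuclideanSpace ℝ (Fin 3)) ≠ t 0 := by
      obtain ⟨z, hz, hq⟩ := h1
      rw [hq]; exact fun h => sublattice_ne hA hI zero_mem_Λ₀ hz (by simpa using h.symm)
    rw [if_pos h1, if_pos hne]
  · rw [if_neg h1, norm_zero]
    exact norm_nonneg _

/-- Every site lies on exactly one sublattice. [folklore] -/
theorem sublattice_cases (hA : Adm₀ A) (hI : Inner₀ t A) (q : Sites₀ t A) :
    ((∃ z ∈ Λ₀, (q : EuclideanSpace ℝ (Fin 3)) = t 0 + A z) ∧ ¬ (∃ z ∈ Λ₀, (q : EuclideanSpace ℝ (Fin 3)) = t 1 + A z)) ∨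
    (¬ (∃ z ∈ Λ₀, (q : EuclideanSpace ℝ (Fin 3)) = t 0 + A z) ∧ (∃ z ∈ Λ₀, (q : EuclideanSpace ℝ (Fin 3)) = t 1 + A z)) := by
  have hex : ∀ (z z' : EuclideanSpace ℝ (Fin 3)), z ∈ Λ₀ → z' ∈ Λ₀ → (q : EuclideanSpace ℝ (Fin 3)) = t 0 + A z →
      (q : EuclideanSpace ℝ (Fin 3)) ≠ t 1 + A z' := fun z z' hz hz' h h' => sublattice_ne hA hI hz hz' (h.symm.trans h')
  obtain ⟨m, z, hz, hq⟩ := q.2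
  fin_cases m
  · exact Or.inl ⟨⟨z, hz, hq⟩, fun ⟨z', hz', h'⟩ => hex z z' hz hz' hq h'⟩
  · refine Or.inr ⟨fun ⟨z', hz', h'⟩ => hex z' z hz' hz h' hq, ⟨z, hz, hq⟩⟩

/-! ## The cross-sublattice identity -/

/-- **The cross-sublattice identity** (see the module docstring): at every site `p`,
`Σ_q T_q(p) = δ_a ξ (p) − (G_a − G_b)(K_c ξ)(p)` as a `HasSum` over the sites. [folklore] -/
theorem cross_identity (hA : Adm₀ A) (hI : Inner₀ t A) {C₀ C₁ : ℝ} (hC₀ : 0 ≤ C₀)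
    (hpath : ∀ w : EuclideanSpace ℝ (Fin 3) → EuclideanSpace ℝ (Fin 3), (Function.support w).Finite →
      Function.support w ⊆ Sites₀ t A → ∀ p ∈ Sites₀ t A, ∀ q ∈ Sites₀ t A,
        ‖w p - w q‖ ≤ C₀ * (1 + dist p q) * Real.sqrt (nnForm t A w))
    (hcap : ∀ w : EuclideanSpace ℝ (Fin 3) → EuclideanSpace ℝ (Fin 3), (Function.support w).Finite →
      Function.support w ⊆ Sites₀ t A → ∀ p ∈ Sites₀ t A, ‖w p‖ ^ 2 ≤ C₁ * nnForm t A w)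
    (hv : ∀ (f : EuclideanSpace ℝ (Fin 3) → EuclideanSpace ℝ (Fin 3)) (N : ℝ), 0 ≤ N →
      (∀ w : EuclideanSpace ℝ (Fin 3) → EuclideanSpace ℝ (Fin 3), (Function.support w).Finite → Function.support w ⊆ Sites₀ t A → |∑' p : Sites₀ t A, ⟪f p, w p⟫| ≤ N * Real.sqrt (nnForm t A w)) →
      ∀ c : ℝ, ∀ p ∈ Sites₀ t A, 𝒢 (c • f) p = c • 𝒢 f p)
    (hvi : ∀ (f : EuclideanSpace ℝ (Fin 3) → EuclideanSpace ℝ (Fin 3)) (N : ℝ), 0 ≤ N →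
      (∀ w : EuclideanSpace ℝ (Fin 3) → EuclideanSpace ℝ (Fin 3), (Function.support w).Finite → Function.support w ⊆ Sites₀ t A → |∑' p : Sites₀ t A, ⟪f p, w p⟫| ≤ N * Real.sqrt (nnForm t A w)) →
      ∀ e ∈ Λ₀, (∀ w : EuclideanSpace ℝ (Fin 3) → EuclideanSpace ℝ (Fin 3), (Function.support w).Finite → Function.support w ⊆ Sites₀ t A → |∑' p : Sites₀ t A, ⟪(fun x => f (x - A e)) p, w p⟫| ≤ N * Real.sqrt (nnForm t A w)) →
      ∀ p ∈ Sites₀ t A, 𝒢 (fun x => f (x - A e)) p = 𝒢 f (p - A e))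
    (hvii : ∀ (f g : EuclideanSpace ℝ (Fin 3) → EuclideanSpace ℝ (Fin 3)) (Nf Ng : ℝ), 0 ≤ Nf → 0 ≤ Ng →
      (∀ w : EuclideanSpace ℝ (Fin 3) → EuclideanSpace ℝ (Fin 3), (Function.support w).Finite → Function.support w ⊆ Sites₀ t A → |∑' p : Sites₀ t A, ⟪f p, w p⟫| ≤ Nf * Real.sqrt (nnForm t A w)) →
      (∀ w : EuclideanSpace ℝ (Fin 3) → EuclideanSpace ℝ (Fin 3), (Function.support w).Finite → Function.support w ⊆ Sites₀ t A → |∑' p : Sites₀ t A, ⟪g p, w p⟫| ≤ Ng * Real.sqrt (nnForm t A w)) →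
      ∀ p ∈ Sites₀ t A, 𝒢 (f + g) p = 𝒢 f p + 𝒢 g p)
    (hviii : ∀ (ι : Type) (F : ι → EuclideanSpace ℝ (Fin 3) → EuclideanSpace ℝ (Fin 3)) (Nn : ι → ℝ)
      (f : EuclideanSpace ℝ (Fin 3) → EuclideanSpace ℝ (Fin 3)), (∀ n, 0 ≤ Nn n) → Summable Nn →
      (∀ n, (∀ w : EuclideanSpace ℝ (Fin 3) → EuclideanSpace ℝ (Fin 3), (Function.support w).Finite → Function.support w ⊆ Sites₀ t A → |∑' p : Sites₀ t A, ⟪(F n) p, w p⟫| ≤ Nn n * Real.sqrt (nnForm t A w))) →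
      (∀ p ∈ Sites₀ t A, HasSum (fun n => F n p) (f p)) → ∀ p ∈ Sites₀ t A, HasSum (fun n => 𝒢 (F n) p) (𝒢 f p))
    (hix : ∀ φ : EuclideanSpace ℝ (Fin 3) → EuclideanSpace ℝ (Fin 3), (Function.support φ).Finite → Function.support φ ⊆ Sites₀ t A →
      ∀ (g : EuclideanSpace ℝ (Fin 3) → EuclideanSpace ℝ (Fin 3)) (N : ℝ), 0 ≤ N →
      (∀ p : Sites₀ t A, HasSum (fun q : Sites₀ t A => forceConst ((p : EuclideanSpace ℝ (Fin 3)) - q) (φ p - φ q)) (g p)) →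
      (∀ w : EuclideanSpace ℝ (Fin 3) → EuclideanSpace ℝ (Fin 3), (Function.support w).Finite → Function.support w ⊆ Sites₀ t A → |∑' p : Sites₀ t A, ⟪g p, w p⟫| ≤ N * Real.sqrt (nnForm t A w)) →
      ∀ p ∈ Sites₀ t A, 𝒢 g p = φ p)
    (ξ : EuclideanSpace ℝ (Fin 3)) {p : EuclideanSpace ℝ (Fin 3)} (hp : p ∈ Sites₀ t A) :
    HasSum (fun q : Sites₀ t A => ((if (∃ z ∈ Λ₀, (q : EuclideanSpace ℝ (Fin 3)) = t 1 + A z) then 𝒢 (fun y : EuclideanSpace ℝ (Fin 3) => if y = t 1 then forceConst (t 0 - q) ξ else 0) p - 𝒢 (fun y : EuclideanSpace ℝ (Fin 3) => if y = t 1 then forceConst (t 0 - q) ξ else 0) (p - q + t 1) else 0) +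
        (if (∃ z ∈ Λ₀, (q : EuclideanSpace ℝ (Fin 3)) = t 0 + A z) then 𝒢 (fun y : EuclideanSpace ℝ (Fin 3) => if y = t 0 then forceConst (t 0 - q) ξ else 0) p - 𝒢 (fun y : EuclideanSpace ℝ (Fin 3) => if y = t 0 then forceConst (t 0 - q) ξ else 0) (p - q + t 0) else 0)))
      ((if p = t 0 then ξ else 0) -
        (𝒢 (fun y : EuclideanSpace ℝ (Fin 3) => if y = t 0 then (∑' q : Sites₀ t A, (if (∃ z ∈ Λ₀, (q : EuclideanSpace ℝ (Fin 3)) = t 1 + A z) then forceConst (t 0 - q) ξ else 0)) else 0) p -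
          𝒢 (fun y : EuclideanSpace ℝ (Fin 3) => if y = t 1 then (∑' q : Sites₀ t A, (if (∃ z ∈ Λ₀, (q : EuclideanSpace ℝ (Fin 3)) = t 1 + A z) then forceConst (t 0 - q) ξ else 0)) else 0) p)) := by
  have ha : t 0 ∈ Sites₀ t A := ⟨0, 0, zero_mem_Λ₀, by simp⟩
  have hb : t 1 ∈ Sites₀ t A := ⟨1, 0, zero_mem_Λ₀, by simp⟩
  have hab : (t 0 : EuclideanSpace ℝ (Fin 3)) ≠ t 1 := fun h => sublattice_ne hA hI zero_mem_Λ₀ zero_mem_Λ₀ (by simpa using h)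
  -- Step 1: `𝒢` applied to the dipole decomposition of `L(δ_a ξ)` reproduces `δ_a ξ`
  set φ : EuclideanSpace ℝ (Fin 3) → EuclideanSpace ℝ (Fin 3) := fun y => if y = t 0 then ξ else 0 with hφ
  set gfun : EuclideanSpace ℝ (Fin 3) → EuclideanSpace ℝ (Fin 3) := fun y => if y = t 0 then
      ∑' q : Sites₀ t A, (if (q : EuclideanSpace ℝ (Fin 3)) ≠ t 0 then forceConst (t 0 - q) ξ else 0)
    else -forceConst (t 0 - y) ξ with hgfun
  set F : Sites₀ t A → EuclideanSpace ℝ (Fin 3) → EuclideanSpace ℝ (Fin 3) := fun q y =>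
      (if y = t 0 then forceConst (t 0 - q) ξ else 0) - (if y = q then forceConst (t 0 - q) ξ else 0) with hF
  set Nn : Sites₀ t A → ℝ := fun q => C₀ * (1 + dist (t 0) (q : EuclideanSpace ℝ (Fin 3))) * ‖forceConst (t 0 - q) ξ‖ with hNn
  have hφval : ∀ y : EuclideanSpace ℝ (Fin 3), y ≠ t 0 → φ y = 0 := fun y hy => by
    simp only [hφ]; rw [if_neg hy]
  have hφfin : (Function.support φ).Finite := (Set.finite_singleton (t 0)).subset fun y hy => by
    rw [Set.mem_singleton_iff]
    by_contra h; exact hy (hφval y h)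
  have hφS : Function.support φ ⊆ Sites₀ t A := fun y hy => by
    have : y = t 0 := by by_contra h; exact hy (hφval y h)
    rw [this]; exact ha
  obtain ⟨hNs, -⟩ := summable_dipole_bounds hA hI hC₀ ha ξ
  have hstep1 : HasSum (fun q : Sites₀ t A => 𝒢 (F q) p) (φ p) := by
    have h1 := hviii (Sites₀ t A) F Nn gfun (fun q => by positivity) hNs
      (fun q => adm_dipole (t := t) (A := A) hpath ha q.2 (forceConst (t 0 - q) ξ)) (fun y hy => single_rows_dipoles hA hI ha ξ hy) p hp
    have h2 : 𝒢 gfun p = φ p :=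
      hix φ hφfin hφS gfun ((38 * (1024 / ((23 / 25 : ℝ) ^ 3 * (23 / 25 : ℝ) ^ 5) +
        1024 / ((23 / 25 : ℝ) ^ 3 * (23 / 25 : ℝ) ^ 4)) * C₀ * ‖ξ‖)) (by positivity)
        (fun q => single_rows hA hI ha ξ q) (single_rows_adm hA hI hC₀ hpath ha ξ) p hp
    rw [h2] at h1
    exact h1
  -- Step 2: each dipole response, moved to `a` or `b`
  have hstep2 : ∀ q : Sites₀ t A, 𝒢 (F q) p =
      (if (∃ z ∈ Λ₀, (q : EuclideanSpace ℝ (Fin 3)) = t 1 + A z) then 𝒢 (fun y : EuclideanSpace ℝ (Fin 3) => if y = t 0 then forceConst (t 0 - q) ξ else 0) p - 𝒢 (fun y : EuclideanSpace ℝ (Fin 3) => if y = t 1 then forceConst (t 0 - q) ξ else 0) p else 0) + ((if (∃ z ∈ Λ₀, (q : EuclideanSpace ℝ (Fin 3)) = t 1 + A z) then 𝒢 (fun y : EuclideanSpace ℝ (Fin 3) => if y = t 1 then forceConst (t 0 - q) ξ else 0) p - 𝒢 (fun y : EuclideanSpace ℝ (Fin 3) => if y = t 1 then forceConst (t 0 -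 q) ξ else 0) (p - q + t 1) else 0) +
        (if (∃ z ∈ Λ₀, (q : EuclideanSpace ℝ (Fin 3)) = t 0 + A z) then 𝒢 (fun y : EuclideanSpace ℝ (Fin 3) => if y = t 0 then forceConst (t 0 - q) ξ else 0) p - 𝒢 (fun y : EuclideanSpace ℝ (Fin 3) => if y = t 0 then forceConst (t 0 - q) ξ else 0) (p - q + t 0) else 0)) := by
    intro q
    have hdip := green_dipole_eq (𝒢 := 𝒢) hcap hv hvii ha q.2 (forceConst (t 0 - q) ξ) hp
    rw [show F q = fun y : EuclideanSpace ℝ (Fin 3) => (if y = t 0 then forceConst (t 0 - q) ξ else 0) -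
        (if y = q then forceConst (t 0 - q) ξ else 0) from rfl, hdip]
    rcases sublattice_cases hA hI q with ⟨h0q, h1q⟩ | ⟨h0q, h1q⟩
    · -- `q ∈ S₀`: `q = a + A z`
      obtain ⟨z, hz, hqz⟩ := h0q
      rw [if_neg h1q, if_neg h1q, if_pos ⟨z, hz, hqz⟩, zero_add, zero_add]
      have htr := green_single_translate (t := t) (A := A) 𝒢 hcap hvi ha hz (forceConst (t 0 - q) ξ) hp
      have hq' : (fun y : EuclideanSpace ℝ (Fin 3) => if y = (q : EuclideanSpace ℝ (Fin 3)) then forceConst (t 0 - q) ξ else 0) =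
          fun y => if y = t 0 + A z then forceConst (t 0 - q) ξ else 0 := by rw [hqz]
      rw [hq', htr, show p - A z = p - q + t 0 by rw [hqz]; abel]
    · -- `q ∈ S₁`: `q = b + A z`
      obtain ⟨z, hz, hqz⟩ := h1q
      rw [if_pos ⟨z, hz, hqz⟩, if_pos ⟨z, hz, hqz⟩, if_neg h0q, add_zero]
      have htr := green_single_translate (t := t) (A := A) 𝒢 hcap hvi hb hz (forceConst (t 0 - q) ξ) hp
      have hq' : (fun y : EuclideanSpace ℝ (Fin 3) => if y = (q : EuclideanSpace ℝ (Fin 3)) then forceConst (t 0 - q) ξ else 0) =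
          fun y => if y = t 1 + A z then forceConst (t 0 - q) ξ else 0 := by rw [hqz]
      rw [hq', htr, show p - A z = p - q + t 1 by rw [hqz]; abel]
      abel
  -- Step 3: the `S₁`-dipoles at `a, b` sum to the response of `(δ_a − δ_b)(K_c ξ)`
  set H : Sites₀ t A → EuclideanSpace ℝ (Fin 3) → EuclideanSpace ℝ (Fin 3) := fun q y =>
      if (∃ z ∈ Λ₀, (q : EuclideanSpace ℝ (Fin 3)) = t 1 + A z) then ((if y = t 0 then forceConst (t 0 - q) ξ else 0) - (if y = t 1 then forceConst (t 0 - q) ξ else 0)) else 0 with hH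
  set Mn : Sites₀ t A → ℝ := fun q => if (∃ z ∈ Λ₀, (q : EuclideanSpace ℝ (Fin 3)) = t 1 + A z) then C₀ * (1 + dist (t 0) (t 1)) * ‖forceConst (t 0 - q) ξ‖ else 0 with hMn
  have hMn0 : ∀ q, 0 ≤ Mn q := fun q => by simp only [hMn]; split_ifs <;> positivity
  have hMns : Summable Mn := by
    refine Summable.of_nonneg_of_le hMn0 (fun q => ?_) (hNs.mul_left (1 + dist (t 0) (t 1)))
    simp only [hMn]
    split_ifs with h1
    · have hd : 0 ≤ dist (t 0) (q : EuclideanSpace ℝ (Fin 3)) := dist_nonneg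
      have hd' : 0 ≤ dist (t 0) (t 1) := dist_nonneg
      have hn : 0 ≤ ‖forceConst (t 0 - q) ξ‖ := norm_nonneg _
      nlinarith [mul_nonneg hC₀ hn, mul_nonneg (mul_nonneg hC₀ hn) (mul_nonneg hd hd')]
    · positivity
  have hMadm : ∀ q : Sites₀ t A, ∀ w : EuclideanSpace ℝ (Fin 3) → EuclideanSpace ℝ (Fin 3), (Function.support w).Finite →
      Function.support w ⊆ Sites₀ t A → |∑' p : Sites₀ t A, ⟪(H q) p, w p⟫| ≤ Mn q * Real.sqrt (nnForm t A w) := by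
    intro q w hw hwS
    simp only [hH, hMn]
    by_cases h1 : (∃ z ∈ Λ₀, (q : EuclideanSpace ℝ (Fin 3)) = t 1 + A z)
    · simp only [if_pos h1]
      exact adm_dipole (t := t) (A := A) hpath ha hb (forceConst (t 0 - q) ξ) w hw hwS
    · simp only [if_neg h1]
      exact adm_zero (t := t) (A := A) w hw hwS
  have hKs := summable_crossVec hA hI ξ
  have hHsum : ∀ y ∈ Sites₀ t A, HasSum (fun q => H q y) ((fun y : EuclideanSpace ℝ (Fin 3) => if y = t 0 then (∑' q : Sites₀ t A, (if (∃ z ∈ Λ₀, (q : EuclideanSpace ℝ (Fin 3)) = t 1 + A z) then forceConst (t 0 - q) ξ else 0)) else 0) y - (fun y : EuclideanSpace ℝ (Fin 3) => if y = t 1 then (∑' q : Sites₀ t A, (if (∃ z ∈ Λ₀, (q : EuclideanSpace ℝ (Fin 3)) = t 1 + A z) then forceConst (t 0 - q) ξ else 0)) else 0) y) := by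
    intro y _
    by_cases hya : y = t 0
    · have hfun : (fun q => H q y) = fun q : Sites₀ t A => (if (∃ z ∈ Λ₀, (q : EuclideanSpace ℝ (Fin 3)) = t 1 + A z) then forceConst (t 0 - q) ξ else 0) := by
        funext q
        simp only [hH, hya, if_true, if_neg hab, sub_zero]
      rw [hfun]
      simp only [hya, if_true, if_neg hab, sub_zero]
      exact hKs.hasSum
    · by_cases hyb : y = t 1
      · have hfun : (fun q => H q y) = fun q : Sites₀ t A => -(if (∃ z ∈ Λ₀, (q : EuclideanSpace ℝ (Fin 3)) = t 1 + A z) then forceConst (t 0 - q) ξ else 0) := by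
          funext q
          simp only [hH, hyb, if_true, if_neg (Ne.symm hab), zero_sub]
          split_ifs <;> simp
        rw [hfun]
        simp only [hyb, if_true, if_neg (Ne.symm hab), zero_sub]
        exact hKs.hasSum.neg
      · have hfun : (fun q => H q y) = fun _ : Sites₀ t A => (0 : EuclideanSpace ℝ (Fin 3)) := by
          funext q
          simp only [hH, if_neg hya, if_neg hyb, sub_zero]
          split_ifs <;> simp
        rw [hfun]
        simp only [if_neg hya, if_neg hyb, sub_zero]
        exact hasSum_zero
  have hstep3 := hviii (Sites₀ t A) H Mn (fun y => (fun y : EuclideanSpace ℝ (Fin 3) => if y = t 0 then (∑' q : Sites₀ t A, (if (∃ z ∈ Λ₀, (q : EuclideanSpace ℝ (Fin 3)) = t 1 + A z) then forceConst (t 0 - q) ξ else 0)) else 0) y - (fun y : EuclideanSpace ℝ (Fin 3) => if y = t 1 then (∑' q : Sites₀ t A, (if (∃ z ∈ Λ₀, (q : EuclideanSpace ℝ (Fin 3)) = t 1 + A z) then forceConst (t 0 - q) ξ else 0)) else 0) y) hMn0 hMns hMadm hHsum p hp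
  have hf3 : 𝒢 (fun y => (fun y : EuclideanSpace ℝ (Fin 3) => if y = t 0 then (∑' q : Sites₀ t A, (if (∃ z ∈ Λ₀, (q : EuclideanSpace ℝ (Fin 3)) = t 1 + A z) then forceConst (t 0 - q) ξ else 0)) else 0) y - (fun y : EuclideanSpace ℝ (Fin 3) => if y = t 1 then (∑' q : Sites₀ t A, (if (∃ z ∈ Λ₀, (q : EuclideanSpace ℝ (Fin 3)) = t 1 + A z) then forceConst (t 0 - q) ξ else 0)) else 0) y) p =
      𝒢 (fun y : EuclideanSpace ℝ (Fin 3) => if y = t 0 then (∑' q : Sites₀ t A, (if (∃ z ∈ Λ₀, (q : EuclideanSpace ℝ (Fin 3)) = t 1 + A z) then forceConst (t 0 - q) ξ else 0)) else 0) p - 𝒢 (fun y : EuclideanSpace ℝ (Fin 3) => if y = t 1 then (∑' q : Sites₀ t A, (if (∃ z ∈ Λ₀, (q : EuclideanSpace ℝ (Fin 3)) = t 1 + A z) then forceConst (t 0 - q) ξ else 0)) else 0) p :=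
    green_dipole_eq (𝒢 := 𝒢) hcap hv hvii ha hb _ hp
  have hH3 : ∀ q : Sites₀ t A, 𝒢 (H q) p =
      (if (∃ z ∈ Λ₀, (q : EuclideanSpace ℝ (Fin 3)) = t 1 + A z) then 𝒢 (fun y : EuclideanSpace ℝ (Fin 3) => if y = t 0 then forceConst (t 0 - q) ξ else 0) p - 𝒢 (fun y : EuclideanSpace ℝ (Fin 3) => if y = t 1 then forceConst (t 0 - q) ξ else 0) p else 0) := by
    intro q
    by_cases h1 : (∃ z ∈ Λ₀, (q : EuclideanSpace ℝ (Fin 3)) = t 1 + A z)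
    · have hHq : H q = fun y : EuclideanSpace ℝ (Fin 3) => (if y = t 0 then forceConst (t 0 - q) ξ else 0) -
          (if y = t 1 then forceConst (t 0 - q) ξ else 0) := by
        funext y; simp only [hH, if_pos h1]
      rw [hHq, if_pos h1]
      exact green_dipole_eq (𝒢 := 𝒢) hcap hv hvii ha hb _ hp
    · have hHq : H q = (0 : EuclideanSpace ℝ (Fin 3) → EuclideanSpace ℝ (Fin 3)) := by
        funext y; simp only [hH, if_neg h1, Pi.zero_apply]
      rw [hHq, if_neg h1]
      exact green_zero (𝒢 := 𝒢) hv hp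
  rw [hf3] at hstep3
  simp only [hH3] at hstep3
  -- Step 4: subtract
  have hfinal := hstep1.sub hstep3
  convert hfinal using 1
  funext q
  rw [hstep2 q]
  abel

/-! ## Sums of admissible right-hand sides -/

/-- **A convergent sum of admissible fields is admissible** with the sum of the bounds. [folklore] -/
theorem adm_of_hasSum {ι : Type*} (F : ι → EuclideanSpace ℝ (Fin 3) → EuclideanSpace ℝ (Fin 3)) (Nn : ι → ℝ)
    (f : EuclideanSpace ℝ (Fin 3) → EuclideanSpace ℝ (Fin 3)) (_hN0 : ∀ n, 0 ≤ Nn n) (hNs : Summable Nn)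
    (hF : ∀ n, (∀ w : EuclideanSpace ℝ (Fin 3) → EuclideanSpace ℝ (Fin 3), (Function.support w).Finite → Function.support w ⊆ Sites₀ t A → |∑' p : Sites₀ t A, ⟪(F n) p, w p⟫| ≤ Nn n * Real.sqrt (nnForm t A w)))
    (hsum : ∀ p ∈ Sites₀ t A, HasSum (fun n => F n p) (f p)) :
    (∀ w : EuclideanSpace ℝ (Fin 3) → EuclideanSpace ℝ (Fin 3), (Function.support w).Finite → Function.support w ⊆ Sites₀ t A → |∑' p : Sites₀ t A, ⟪f p, w p⟫| ≤ (∑' n, Nn n) * Real.sqrt (nnForm t A w)) := by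
  classical
  intro w hw hwS
  set s : Finset (Sites₀ t A) := (hw.preimage Subtype.val_injective.injOn).toFinset with hs
  have hmem : ∀ p : Sites₀ t A, p ∉ s → w p = 0 := by
    intro p hp
    by_contra h
    exact hp ((Set.Finite.mem_toFinset _).2 h)
  -- the pairing of `f` as a finite sum of convergent series
  have h1 : ∑' p : Sites₀ t A, ⟪f p, w p⟫ = ∑ p ∈ s, ⟪f p, w p⟫ :=
    tsum_eq_sum fun p hp => by rw [hmem p hp, inner_zero_right]
  have h2 : ∀ p : Sites₀ t A, HasSum (fun n => ⟪F n p, w p⟫) ⟪f p, w p⟫ := by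
    intro p
    have h := (hsum p p.2).mapL (innerSL ℝ (w p))
    simp only [innerSL_apply_apply] at h
    simpa only [real_inner_comm] using h
  have h3 : ∑ p ∈ s, ⟪f p, w p⟫ = ∑' n, ∑ p ∈ s, ⟪F n p, w p⟫ := by
    rw [Summable.tsum_finsetSum fun p _ => (h2 p).summable]
    exact Finset.sum_congr rfl fun p _ => (h2 p).tsum_eq.symm
  have h4 : ∀ n, ∑ p ∈ s, ⟪F n p, w p⟫ = ∑' p : Sites₀ t A, ⟪F n p, w p⟫ :=
    fun n => (tsum_eq_sum fun p hp => by rw [hmem p hp, inner_zero_right]).symm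
  simp only [h4] at h3
  rw [h1, h3]
  have h5 : ∀ n, ‖∑' p : Sites₀ t A, ⟪F n p, w p⟫‖ ≤ Nn n * Real.sqrt (nnForm t A w) := fun n => by
    rw [Real.norm_eq_abs]; exact hF n w hw hwS
  have h6 : Summable (fun n => Nn n * Real.sqrt (nnForm t A w)) := hNs.mul_right _
  calc |∑' n, ∑' p : Sites₀ t A, ⟪F n p, w p⟫| = ‖∑' n, ∑' p : Sites₀ t A, ⟪F n p, w p⟫‖ := (Real.norm_eq_abs _).symm
    _ ≤ ∑' n, Nn n * Real.sqrt (nnForm t A w) := tsum_of_norm_bounded h6.hasSum h5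
    _ = (∑' n, Nn n) * Real.sqrt (nnForm t A w) := tsum_mul_right



/-- Registered sub-goal carrying this file (crux stmt-AtomisticToContinuum-9332, line `Sketch` v4, part H3d-II of
`stub_green`): a convergent sum of admissible right-hand sides is admissible. [folklore] -/
theorem _root_.Summit.AtomisticToContinuum.Crystallization.Theorems.ExcessDecayLiouville.blowdown_admOfHasSum :
    ∀ (t : Fin 2 → EuclideanSpace ℝ (Fin 3)) (A : EuclideanSpace ℝ (Fin 3) →L[ℝ] EuclideanSpace ℝ (Fin 3)) (ι : Type) (F : ι → EuclideanSpace ℝ (Fin 3) → EuclideanSpace ℝ (Fin 3)) (Nn : ι → ℝ) (f : EuclideanSpace ℝ (Fin 3) → EuclideanSpace ℝ (Fin 3)), (∀ n, 0 ≤ Nn n) → Summable Nn → (∀ n, (∀ w : EuclideanSpace ℝ (Fin 3) → EuclideanSpace ℝ (Fin 3), (Function.support w).Finite → Function.support w ⊆ Sites₀ t A → |∑' p : Sites₀ t A, ⟪(F n) p, w p⟫| ≤ Nn n * Real.sqrt (nnForm t A w))) → (∀ p ∈ Sites₀ t A, HasSum (fun n => F n p) (f p)) → (∀ w : EuclideanSpace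 ℝ (Fin 3) → EuclideanSpace ℝ (Fin 3), (Function.support w).Finite → Function.support w ⊆ Sites₀ t A → |∑' p : Sites₀ t A, ⟪f p, w p⟫| ≤ (∑' n, Nn n) * Real.sqrt (nnForm t A w)) :=
  fun _ _ _ F Nn f hN0 hNs hF hsum => adm_of_hasSum F Nn f hN0 hNs hF hsum

end

end Blowdown

end Summit.AtomisticToContinuum.Crystallization.Theorems.ExcessDecayLiouville

end
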